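import Literature.Analysis.UnboundedOperators.LinearizedBoltzmannGainForms
import Literature.MathematicalPhysics.KineticTheory.BoltzmannSolutionsUkaiVelocity
import HarnessLib

/-!
# The linearised hard-sphere operator on quartic-growth functions: weak formulation against `L²(M dv)`

Sibling proof file of `LinearizedBoltzmannGainForms.lean` and `LinearizedBoltzmannSymmetryProofs.lean`.
For a measurable `ψ` of quartic growth `|ψ(v)| ≤ A (1 + |v|²)²` — the growth class of the
Chapman–Enskog inverse `L⁻¹ g` of a bounded `g` (`LinearizedBoltzmannPolynomialInverse`) — write
`Tψ (v, v_*, ω) = ψ(v') + ψ(v_*') - ψ(v) - ψ(v_*)` for the collisional transfer and `B M M_*` for the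
collision density (`collisionDensity`) on `E × E × S^{d-1}` with `dλ = dv dv_* dω`. This file proves:

* `exists_lintegral_collisionDensity_transfer_mul_le` — the **Gaussian-moment Cauchy–Schwarz bound**
  `∫ B M M_* |Tψ| |F(v, v_*)| dλ ≤ K A ‖F‖_{L²(M ⊗ M)}` with an absolute `K` (all Gaussian moments of
  the polynomial weight `(1 + |v|)^5 (1 + |v_*|)^5` are finite), and its tensor form
  `… |h₁(v)| |h₂(v_*)| … ≤ K A ‖h₁‖_{L²(M)} ‖h₂‖_{L²(M)}` (`lintegral_collisionDensity_transfer_mul_mul_le`);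
* `lintegral_collisionDensity_transfer_sq_lt_top` — `∫ B M M_* (Tψ)² dλ < ∞`;
* `integral_collisionDensity_transfer_mul_eq_maxwellian` — the **weak formulation**
  `∫ B M M_* (Tψ) h(v) dλ = ∫ h (L ψ) dM` for every `h ∈ L²(M dv)` (Fubini; CIP 1994 §7.1 (7.1.6)–(7.1.7)
  for temperate `ψ, h` is `maxwellianInner_linearizedCollisionOp_eq`);
* the two involution identities `∫ B M M_* (Tψ) h(v_*) = ∫ B M M_* (Tψ) h(v)` (exchange
  `(v, v_*, ω) ↦ (v_*, v, -ω)`) and `∫ B M M_* (Tψ) u(v', v_*') = -∫ B M M_* (Tψ) u(v, v_*)`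
  (pre/post `(v, v_*, ω) ↦ (v', v_*', -ω)`), valid without any integrability.

These are the collision-space half of the nonlinear gain–dissipation estimate of a one-body density
against a fast observable `g = L ψ` (Hellinger entropy production). No definitions are introduced.

## References

* C. Cercignani, R. Illner, M. Pulvirenti, *The Mathematical Theory of Dilute Gases*, Springer (1994),
  §7.1 (7.1.6)–(7.1.7), §7.2.
-/

open MeasureTheory Metric Real Set Filter Topology ProbabilityTheory Module
open scoped InnerProductSpace ENNReal

namespace Literature.Analysis.UnboundedOperators

noncomputable section

open Literature.MathematicalPhysics.KineticTheory (collide sphereMeasure hardSphereKernel collide_collide)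
open Literature.MathematicalPhysics.KineticTheory.UkaiLanford (hardSphereKernel_le_weight)
open Literature.Analysis.FluidPDE

variable {E : Type*} [NormedAddCommGroup E] [InnerProductSpace ℝ E] [FiniteDimensional ℝ E]
  [MeasurableSpace E] [BorelSpace E]

/-! ### Pointwise bounds -/

omit [InnerProductSpace ℝ E] [FiniteDimensional ℝ E] [MeasurableSpace E] [BorelSpace E] in
/-- Quartic growth in `|v|²` is quartic growth in `1 + |v|`: `A (1 + |u|²)² ≤ A (1 + |u|)⁴` and `A ≥ 0`.
[folklore] -/
theorem abs_le_one_add_norm_pow_four_of_quartic {ψ : E → ℝ} {A : ℝ}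
    (hψ : ∀ u, |ψ u| ≤ A * (1 + ‖u‖ ^ 2) ^ 2) :
    0 ≤ A ∧ ∀ u, |ψ u| ≤ A * (1 + ‖u‖) ^ 4 := by
  have hA : 0 ≤ A := by
    have h := hψ 0
    rw [norm_zero] at h
    norm_num at h
    exact (abs_nonneg _).trans h
  refine ⟨hA, fun u => (hψ u).trans (mul_le_mul_of_nonneg_left ?_ hA)⟩
  have h1 : 1 + ‖u‖ ^ 2 ≤ (1 + ‖u‖) ^ 2 := by nlinarith [norm_nonneg u]
  calc (1 + ‖u‖ ^ 2) ^ 2 ≤ ((1 + ‖u‖) ^ 2) ^ 2 := pow_le_pow_left₀ (by positivity) h1 2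
    _ = (1 + ‖u‖) ^ 4 := by ring

omit [FiniteDimensional ℝ E] [MeasurableSpace E] [BorelSpace E] in
/-- **The collisional transfer of a quartic-growth function**:
`|ψ(v') + ψ(v_*') - ψ(v) - ψ(v_*)| ≤ 4 A ((1 + |v|)(1 + |v_*|))⁴` (conservation of energy). [folklore] -/
theorem abs_transfer_le_of_quartic {ψ : E → ℝ} {A : ℝ} (hψ : ∀ u, |ψ u| ≤ A * (1 + ‖u‖ ^ 2) ^ 2)
    (q : (E × E) × sphere (0 : E) 1) :
    |ψ (collide q.2 q.1).1 + ψ (collide q.2 q.1).2 - ψ q.1.1 - ψ q.1.2| ≤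
      4 * A * ((1 + ‖q.1.1‖) * (1 + ‖q.1.2‖)) ^ 4 := by
  obtain ⟨hA, h4⟩ := abs_le_one_add_norm_pow_four_of_quartic hψ
  have h := abs_collisionDiff_mul_le (g := ψ) (h := fun _ : E => (1 : ℝ)) (a := 4) (b := 0) hA
    zero_le_one h4 (fun u => by simp) q.1 q.2 (one_add_norm_fst_le q.1)
  simpa only [mul_one, add_zero] using h

omit [FiniteDimensional ℝ E] [MeasurableSpace E] [BorelSpace E] in
/-- `B M M_* |Tψ| ≤ M(v) M(v_*) · 4A ((1 + |v|)(1 + |v_*|))⁵`. [folklore] -/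
theorem collisionDensity_mul_abs_transfer_le {ψ : E → ℝ} {A : ℝ}
    (hψ : ∀ u, |ψ u| ≤ A * (1 + ‖u‖ ^ 2) ^ 2) (q : (E × E) × sphere (0 : E) 1) :
    collisionDensity q * |ψ (collide q.2 q.1).1 + ψ (collide q.2 q.1).2 - ψ q.1.1 - ψ q.1.2| ≤
      globalMaxwellian q.1.1 * globalMaxwellian q.1.2 *
        (4 * A * ((1 + ‖q.1.1‖) * (1 + ‖q.1.2‖)) ^ 5) := by
  have hA := (abs_le_one_add_norm_pow_four_of_quartic hψ).1
  have hM := mul_nonneg (globalMaxwellian_pos q.1.1).le (globalMaxwellian_pos q.1.2).le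
  have hB := hardSphereKernel_le_weight q.1 q.2
  have hB0 : 0 ≤ hardSphereKernel q.1 q.2 := le_max_right _ _
  have hT := abs_transfer_le_of_quartic hψ q
  calc collisionDensity q * |ψ (collide q.2 q.1).1 + ψ (collide q.2 q.1).2 - ψ q.1.1 - ψ q.1.2|
      = globalMaxwellian q.1.1 * globalMaxwellian q.1.2 * (hardSphereKernel q.1 q.2 *
          |ψ (collide q.2 q.1).1 + ψ (collide q.2 q.1).2 - ψ q.1.1 - ψ q.1.2|) := by
        simp only [collisionDensity]; ring
    _ ≤ globalMaxwellian q.1.1 * globalMaxwellian q.1.2 *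
          (((1 + ‖q.1.1‖) * (1 + ‖q.1.2‖)) * (4 * A * ((1 + ‖q.1.1‖) * (1 + ‖q.1.2‖)) ^ 4)) :=
        mul_le_mul_of_nonneg_left (mul_le_mul hB hT (abs_nonneg _) (by positivity)) hM
    _ = _ := by ring

omit [FiniteDimensional ℝ E] [MeasurableSpace E] [BorelSpace E] in
/-- `B M M_* (Tψ)² ≤ M(v) M(v_*) · 16A² ((1 + |v|)(1 + |v_*|))⁹`. [folklore] -/
theorem collisionDensity_mul_transfer_sq_le {ψ : E → ℝ} {A : ℝ}
    (hψ : ∀ u, |ψ u| ≤ A * (1 + ‖u‖ ^ 2) ^ 2) (q : (E × E) × sphere (0 : E) 1) :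
    collisionDensity q * (ψ (collide q.2 q.1).1 + ψ (collide q.2 q.1).2 - ψ q.1.1 - ψ q.1.2) ^ 2 ≤
      globalMaxwellian q.1.1 * globalMaxwellian q.1.2 *
        (16 * A ^ 2 * ((1 + ‖q.1.1‖) * (1 + ‖q.1.2‖)) ^ 9) := by
  have hM := mul_nonneg (globalMaxwellian_pos q.1.1).le (globalMaxwellian_pos q.1.2).le
  have hB := hardSphereKernel_le_weight q.1 q.2
  have hB0 : 0 ≤ hardSphereKernel q.1 q.2 := le_max_right _ _
  have hT := abs_transfer_le_of_quartic hψ q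
  have hT2 : (ψ (collide q.2 q.1).1 + ψ (collide q.2 q.1).2 - ψ q.1.1 - ψ q.1.2) ^ 2 ≤
      (4 * A * ((1 + ‖q.1.1‖) * (1 + ‖q.1.2‖)) ^ 4) ^ 2 := by
    rw [← sq_abs]
    exact pow_le_pow_left₀ (abs_nonneg _) hT 2
  calc collisionDensity q * (ψ (collide q.2 q.1).1 + ψ (collide q.2 q.1).2 - ψ q.1.1 - ψ q.1.2) ^ 2
      = globalMaxwellian q.1.1 * globalMaxwellian q.1.2 * (hardSphereKernel q.1 q.2 *
          (ψ (collide q.2 q.1).1 + ψ (collide q.2 q.1).2 - ψ q.1.1 - ψ q.1.2) ^ 2) := by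
        simp only [collisionDensity]; ring
    _ ≤ globalMaxwellian q.1.1 * globalMaxwellian q.1.2 *
          (((1 + ‖q.1.1‖) * (1 + ‖q.1.2‖)) * (4 * A * ((1 + ‖q.1.1‖) * (1 + ‖q.1.2‖)) ^ 4) ^ 2) :=
        mul_le_mul_of_nonneg_left (mul_le_mul hB hT2 (sq_nonneg _) (by positivity)) hM
    _ = _ := by ring

/-- The collisional transfer of a measurable function is measurable on `E × E × S^{d-1}`. [folklore] -/
@[fun_prop]
theorem measurable_transfer {ψ : E → ℝ} (hψ : Measurable ψ) :
    Measurable fun q : (E × E) × sphere (0 : E) 1 =>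
      ψ (collide q.2 q.1).1 + ψ (collide q.2 q.1).2 - ψ q.1.1 - ψ q.1.2 := by
  have hc1 : Continuous fun q : (E × E) × sphere (0 : E) 1 => (collide q.2 q.1).1 := by
    unfold collide; fun_prop
  have hc2 : Continuous fun q : (E × E) × sphere (0 : E) 1 => (collide q.2 q.1).2 := by
    unfold collide; fun_prop
  exact (((hψ.comp hc1.measurable).add (hψ.comp hc2.measurable)).sub
    (hψ.comp (measurable_fst.comp measurable_fst))).sub (hψ.comp (measurable_snd.comp measurable_fst))

/-! ### The Maxwellian bridge on collision space and Gaussian moments -/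

/-- **Bridge `M ⊗ M ⊗ dω ↔ dλ`.** For a weight `U(v, v_*)` not depending on `ω`,
`∫ M(v) M(v_*) U(v, v_*) dλ = |S^{d-1}| ∫ U d(M dv ⊗ M dv_*)`. [folklore] -/
theorem lintegral_maxwellian_mul_eq_sphere_mul_lintegral_prod {U : E × E → ℝ≥0∞}
    (hU : AEMeasurable U ((volume : Measure E).prod volume)) :
    ∫⁻ q : (E × E) × sphere (0 : E) 1, ENNReal.ofReal (globalMaxwellian q.1.1) *
        ENNReal.ofReal (globalMaxwellian q.1.2) * U q.1 ∂(((volume : Measure E).prod volume).prod sphereMeasure) =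
      (sphereMeasure : Measure (sphere (0 : E) 1)) univ *
        ∫⁻ p, U p ∂((stdGaussian E).prod (stdGaussian E)) := by
  have hM : Measurable fun v : E => ENNReal.ofReal (globalMaxwellian v) :=
    continuous_globalMaxwellian.measurable.ennreal_ofReal
  have hMM : AEMeasurable (fun p : E × E => ENNReal.ofReal (globalMaxwellian p.1) *
      ENNReal.ofReal (globalMaxwellian p.2) * U p) ((volume : Measure E).prod volume) :=
    (((hM.comp measurable_fst).mul (hM.comp measurable_snd)).aemeasurable).mul hU
  have h1 : ∫⁻ q : (E × E) × sphere (0 : E) 1, ENNReal.ofReal (globalMaxwellian q.1.1) *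
      ENNReal.ofReal (globalMaxwellian q.1.2) * U q.1 ∂(((volume : Measure E).prod volume).prod sphereMeasure) =
      (∫⁻ p, ENNReal.ofReal (globalMaxwellian p.1) * ENNReal.ofReal (globalMaxwellian p.2) * U p
        ∂((volume : Measure E).prod volume)) * ∫⁻ _ω, (1 : ℝ≥0∞) ∂(sphereMeasure : Measure (sphere (0 : E) 1)) := by
    rw [← lintegral_prod_mul hMM aemeasurable_const]
    simp only [mul_one]
  rw [h1, lintegral_const, one_mul, mul_comm, stdGaussian_eq_withDensity_globalMaxwellian_holds,
    prod_withDensity hM hM]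
  congr 1
  have hf : AEMeasurable (fun z : E × E => ENNReal.ofReal (globalMaxwellian z.1) *
      ENNReal.ofReal (globalMaxwellian z.2)) ((volume : Measure E).prod volume) :=
    ((hM.comp measurable_fst).mul (hM.comp measurable_snd)).aemeasurable
  rw [lintegral_withDensity_eq_lintegral_mul₀ hf hU]
  rfl

/-- **Gaussian moments on the product**: `∫ ((1 + |v|)(1 + |v_*|))^k d(M ⊗ M) < ∞`. [folklore] -/
theorem lintegral_one_add_norm_mul_pow_prod_lt_top (k : ℕ) :
    ∫⁻ p, ENNReal.ofReal (((1 + ‖p.1‖) * (1 + ‖p.2‖)) ^ k) ∂((stdGaussian E).prod (stdGaussian E)) < ∞ := by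
  have hm : AEMeasurable (fun v : E => ENNReal.ofReal ((1 + ‖v‖) ^ k)) (stdGaussian E) := by
    fun_prop
  have hpt : ∀ p : E × E, ENNReal.ofReal (((1 + ‖p.1‖) * (1 + ‖p.2‖)) ^ k) =
      ENNReal.ofReal ((1 + ‖p.1‖) ^ k) * ENNReal.ofReal ((1 + ‖p.2‖) ^ k) := fun p => by
    rw [mul_pow, ENNReal.ofReal_mul (by positivity)]
  simp_rw [hpt]
  rw [lintegral_prod_mul hm hm]
  have hfin := (integrable_one_add_norm_pow_stdGaussian (E := E) k).lintegral_lt_top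
  exact ENNReal.mul_lt_top hfin hfin

/-! ### The Gaussian-moment Cauchy–Schwarz bound -/

/-- `‖h₁ ⊗ h₂‖_{L²(μ ⊗ ν)} = ‖h₁‖_{L²(μ)} ‖h₂‖_{L²(ν)}` (Tonelli). [folklore] -/
theorem eLpNorm_two_tensor {α β : Type*} [MeasurableSpace α] [MeasurableSpace β] {μ : Measure α}
    {ν : Measure β} [SFinite ν] {h₁ : α → ℝ} {h₂ : β → ℝ} (h₁m : AEStronglyMeasurable h₁ μ)
    (h₂m : AEStronglyMeasurable h₂ ν) :
    eLpNorm (fun p : α × β => h₁ p.1 * h₂ p.2) 2 (μ.prod ν) = eLpNorm h₁ 2 μ * eLpNorm h₂ 2 ν := by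
  rw [eLpNorm_eq_lintegral_rpow_enorm_toReal two_ne_zero ENNReal.ofNat_ne_top,
    eLpNorm_eq_lintegral_rpow_enorm_toReal two_ne_zero ENNReal.ofNat_ne_top,
    eLpNorm_eq_lintegral_rpow_enorm_toReal two_ne_zero ENNReal.ofNat_ne_top, ENNReal.toReal_ofNat,
    ← ENNReal.mul_rpow_of_nonneg _ _ (by norm_num : (0 : ℝ) ≤ 1 / 2)]
  congr 1
  have hpt : ∀ p : α × β, ‖h₁ p.1 * h₂ p.2‖ₑ ^ (2 : ℝ) = ‖h₁ p.1‖ₑ ^ (2 : ℝ) * ‖h₂ p.2‖ₑ ^ (2 : ℝ) :=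
    fun p => by rw [enorm_mul, ENNReal.mul_rpow_of_nonneg _ _ two_pos.le]
  simp_rw [hpt]
  exact lintegral_prod_mul (h₁m.enorm.pow_const _) (h₂m.enorm.pow_const _)

/-- **Gaussian-moment Cauchy–Schwarz bound for the transfer of a quartic-growth function.** There is
an absolute constant `K ≥ 0` (depending only on the velocity space) such that for every measurable
`ψ` with `|ψ(v)| ≤ A (1 + |v|²)²` and every `F ∈ L²(M dv ⊗ M dv_*)`,
`∫ B M M_* |ψ' + ψ_*' - ψ - ψ_*| |F(v, v_*)| dλ ≤ K A ‖F‖_{L²(M ⊗ M)}`: bound `B |Tψ|` by the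
polynomial weight `4A ((1 + |v|)(1 + |v_*|))⁵`, integrate out `ω`, and apply Cauchy–Schwarz in
`L²(M ⊗ M)` (all Gaussian moments are finite). [folklore] -/
theorem exists_lintegral_collisionDensity_transfer_mul_le :
    ∃ K : ℝ, 0 ≤ K ∧ ∀ (ψ : E → ℝ) (A : ℝ), (∀ u, |ψ u| ≤ A * (1 + ‖u‖ ^ 2) ^ 2) →
      ∀ F : E × E → ℝ, AEStronglyMeasurable F ((stdGaussian E).prod (stdGaussian E)) →
        ∫⁻ q, ‖collisionDensity q * ((ψ (collide q.2 q.1).1 + ψ (collide q.2 q.1).2 - ψ q.1.1 - ψ q.1.2) *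
            F q.1)‖ₑ ∂(((volume : Measure E).prod volume).prod sphereMeasure) ≤
          ENNReal.ofReal K * ENNReal.ofReal A * eLpNorm F 2 ((stdGaussian E).prod (stdGaussian E)) := by
  haveI := isFiniteMeasure_sphereMeasure (E := E)
  set S : ℝ≥0∞ := (sphereMeasure : Measure (sphere (0 : E) 1)) univ with hS
  set I : ℝ≥0∞ := ∫⁻ p, ENNReal.ofReal (((1 + ‖p.1‖) * (1 + ‖p.2‖)) ^ 10)
    ∂((stdGaussian E).prod (stdGaussian E)) with hI
  have hIt : I ≠ ∞ := (lintegral_one_add_norm_mul_pow_prod_lt_top 10).ne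
  have hSt : S ≠ ∞ := (measure_lt_top _ _).ne
  have hI2 : I ^ (1 / 2 : ℝ) ≠ ∞ := ENNReal.rpow_ne_top_of_nonneg (by norm_num) hIt
  refine ⟨S.toReal * 4 * (I ^ (1 / 2 : ℝ)).toReal, by positivity, fun ψ A hψ F hF => ?_⟩
  have hK : ENNReal.ofReal (S.toReal * 4 * (I ^ (1 / 2 : ℝ)).toReal) = S * 4 * I ^ (1 / 2 : ℝ) := by
    rw [ENNReal.ofReal_mul (by positivity), ENNReal.ofReal_mul ENNReal.toReal_nonneg,
      ENNReal.ofReal_toReal hSt, ENNReal.ofReal_toReal hI2, ENNReal.ofReal_ofNat]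
  obtain ⟨hA, -⟩ := abs_le_one_add_norm_pow_four_of_quartic hψ
  -- the polynomial weight
  set W : E × E → ℝ := fun p => 4 * A * ((1 + ‖p.1‖) * (1 + ‖p.2‖)) ^ 5 with hW
  have hW0 : ∀ p, 0 ≤ W p := fun p => by positivity
  have hWm : Measurable fun p : E × E => ENNReal.ofReal (W p) := by
    simp only [hW]; fun_prop
  have hFv : AEStronglyMeasurable F ((volume : Measure E).prod volume) :=
    hF.mono_ac (volume_absolutelyContinuous_stdGaussian.prod volume_absolutelyContinuous_stdGaussian)
  -- pointwise domination `|B M M_* Tψ F| ≤ M M_* · W |F|`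
  have hpt : ∀ q : (E × E) × sphere (0 : E) 1,
      ‖collisionDensity q * ((ψ (collide q.2 q.1).1 + ψ (collide q.2 q.1).2 - ψ q.1.1 - ψ q.1.2) *
        F q.1)‖ₑ ≤ ENNReal.ofReal (globalMaxwellian q.1.1) * ENNReal.ofReal (globalMaxwellian q.1.2) *
          (ENNReal.ofReal (W q.1) * ‖F q.1‖ₑ) := by
    intro q
    have h := collisionDensity_mul_abs_transfer_le hψ q
    rw [enorm_mul, enorm_mul, ← mul_assoc, Real.enorm_eq_ofReal (collisionDensity_nonneg q),
      Real.enorm_eq_ofReal_abs, ← ENNReal.ofReal_mul (collisionDensity_nonneg q)]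
    calc ENNReal.ofReal (collisionDensity q *
          |ψ (collide q.2 q.1).1 + ψ (collide q.2 q.1).2 - ψ q.1.1 - ψ q.1.2|) * ‖F q.1‖ₑ
        ≤ ENNReal.ofReal (globalMaxwellian q.1.1 * globalMaxwellian q.1.2 * W q.1) * ‖F q.1‖ₑ :=
          mul_le_mul_left (ENNReal.ofReal_le_ofReal h) _
      _ = _ := by
          rw [ENNReal.ofReal_mul (mul_nonneg (globalMaxwellian_pos _).le (globalMaxwellian_pos _).le),
            ENNReal.ofReal_mul (globalMaxwellian_pos _).le]
          ring
  -- Cauchy–Schwarz in `L²(M ⊗ M)`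
  have hCS : ∫⁻ p, ENNReal.ofReal (W p) * ‖F p‖ₑ ∂((stdGaussian E).prod (stdGaussian E)) ≤
      (∫⁻ p, ENNReal.ofReal (W p) ^ (2 : ℝ) ∂((stdGaussian E).prod (stdGaussian E))) ^ (1 / 2 : ℝ) *
        (∫⁻ p, ‖F p‖ₑ ^ (2 : ℝ) ∂((stdGaussian E).prod (stdGaussian E))) ^ (1 / 2 : ℝ) := by
    have h := ENNReal.lintegral_mul_le_Lp_mul_Lq ((stdGaussian E).prod (stdGaussian E))
      Real.HolderConjugate.two_two hWm.aemeasurable hF.enorm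
    simpa only [Pi.mul_apply] using h
  have hWint : (∫⁻ p, ENNReal.ofReal (W p) ^ (2 : ℝ) ∂((stdGaussian E).prod (stdGaussian E))) ^ (1 / 2 : ℝ) =
      ENNReal.ofReal (4 * A) * I ^ (1 / 2 : ℝ) := by
    have h1 : ∀ p : E × E, ENNReal.ofReal (W p) ^ (2 : ℝ) =
        ENNReal.ofReal ((4 * A) ^ 2) * ENNReal.ofReal (((1 + ‖p.1‖) * (1 + ‖p.2‖)) ^ 10) := by
      intro p
      rw [ENNReal.rpow_two, ← ENNReal.ofReal_pow (hW0 p), ← ENNReal.ofReal_mul (sq_nonneg _), hW]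
      ring_nf
    simp_rw [h1]
    rw [lintegral_const_mul _ (by fun_prop), ENNReal.mul_rpow_of_nonneg _ _ (by norm_num : (0 : ℝ) ≤ 1 / 2),
      ENNReal.ofReal_rpow_of_nonneg (sq_nonneg _) (by norm_num : (0 : ℝ) ≤ 1 / 2), ← Real.sqrt_eq_rpow,
      Real.sqrt_sq (by positivity)]
  have hFnorm : (∫⁻ p, ‖F p‖ₑ ^ (2 : ℝ) ∂((stdGaussian E).prod (stdGaussian E))) ^ (1 / 2 : ℝ) =
      eLpNorm F 2 ((stdGaussian E).prod (stdGaussian E)) := by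
    rw [eLpNorm_eq_lintegral_rpow_enorm_toReal two_ne_zero ENNReal.ofNat_ne_top, ENNReal.toReal_ofNat]
  have hU : AEMeasurable (fun p : E × E => ENNReal.ofReal (W p) * ‖F p‖ₑ) ((volume : Measure E).prod volume) :=
    hWm.aemeasurable.mul hFv.enorm
  calc ∫⁻ q, ‖collisionDensity q * ((ψ (collide q.2 q.1).1 + ψ (collide q.2 q.1).2 - ψ q.1.1 - ψ q.1.2) *
          F q.1)‖ₑ ∂(((volume : Measure E).prod volume).prod sphereMeasure)
      ≤ ∫⁻ q : (E × E) × sphere (0 : E) 1, ENNReal.ofReal (globalMaxwellian q.1.1) *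
          ENNReal.ofReal (globalMaxwellian q.1.2) * (ENNReal.ofReal (W q.1) * ‖F q.1‖ₑ)
          ∂(((volume : Measure E).prod volume).prod sphereMeasure) := lintegral_mono hpt
    _ = S * ∫⁻ p, ENNReal.ofReal (W p) * ‖F p‖ₑ ∂((stdGaussian E).prod (stdGaussian E)) :=
        lintegral_maxwellian_mul_eq_sphere_mul_lintegral_prod hU
    _ ≤ S * (ENNReal.ofReal (4 * A) * I ^ (1 / 2 : ℝ) * eLpNorm F 2 ((stdGaussian E).prod (stdGaussian E))) := by
        rw [← hWint, ← hFnorm]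
        exact mul_le_mul_right hCS _
    _ = ENNReal.ofReal (S.toReal * 4 * (I ^ (1 / 2 : ℝ)).toReal) * ENNReal.ofReal A *
          eLpNorm F 2 ((stdGaussian E).prod (stdGaussian E)) := by
        rw [hK, ENNReal.ofReal_mul (by norm_num : (0 : ℝ) ≤ 4), ENNReal.ofReal_ofNat]
        ring

/-- `∫ B M M_* (ψ' + ψ_*' - ψ - ψ_*)² dλ < ∞` for `ψ` of quartic growth (Gaussian moments). [folklore] -/
theorem lintegral_collisionDensity_transfer_sq_lt_top {ψ : E → ℝ} {A : ℝ}
    (hψ : ∀ u, |ψ u| ≤ A * (1 + ‖u‖ ^ 2) ^ 2) :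
    ∫⁻ q, ENNReal.ofReal (collisionDensity q *
        (ψ (collide q.2 q.1).1 + ψ (collide q.2 q.1).2 - ψ q.1.1 - ψ q.1.2) ^ 2)
        ∂(((volume : Measure E).prod volume).prod sphereMeasure) < ∞ := by
  haveI := isFiniteMeasure_sphereMeasure (E := E)
  have hpt : ∀ q : (E × E) × sphere (0 : E) 1, ENNReal.ofReal (collisionDensity q *
      (ψ (collide q.2 q.1).1 + ψ (collide q.2 q.1).2 - ψ q.1.1 - ψ q.1.2) ^ 2) ≤
      ENNReal.ofReal (globalMaxwellian q.1.1) * ENNReal.ofReal (globalMaxwellian q.1.2) *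
        ENNReal.ofReal (16 * A ^ 2 * ((1 + ‖q.1.1‖) * (1 + ‖q.1.2‖)) ^ 9) := by
    intro q
    rw [← ENNReal.ofReal_mul (globalMaxwellian_pos _).le,
      ← ENNReal.ofReal_mul (mul_nonneg (globalMaxwellian_pos _).le (globalMaxwellian_pos _).le)]
    exact ENNReal.ofReal_le_ofReal (collisionDensity_mul_transfer_sq_le hψ q)
  refine lt_of_le_of_lt (lintegral_mono hpt) ?_
  rw [lintegral_maxwellian_mul_eq_sphere_mul_lintegral_prod
    (U := fun p : E × E => ENNReal.ofReal (16 * A ^ 2 * ((1 + ‖p.1‖) * (1 + ‖p.2‖)) ^ 9)) (by fun_prop)]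
  refine ENNReal.mul_lt_top (measure_lt_top _ _) ?_
  have h1 : ∀ p : E × E, ENNReal.ofReal (16 * A ^ 2 * ((1 + ‖p.1‖) * (1 + ‖p.2‖)) ^ 9) =
      ENNReal.ofReal (16 * A ^ 2) * ENNReal.ofReal (((1 + ‖p.1‖) * (1 + ‖p.2‖)) ^ 9) := fun p =>
    ENNReal.ofReal_mul (by positivity)
  simp_rw [h1]
  rw [lintegral_const_mul _ (by fun_prop)]
  exact ENNReal.mul_lt_top ENNReal.ofReal_lt_top (lintegral_one_add_norm_mul_pow_prod_lt_top 9)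

/-- **Integrability of the transfer against `L²` tensors**: for `ψ` measurable of quartic growth and
`h₁, h₂ ∈ L²(M dv)`, `B M M_* (ψ' + ψ_*' - ψ - ψ_*) h₁(v) h₂(v_*)` is `dλ`-integrable. [folklore] -/
theorem integrable_collisionDensity_transfer_mul_mul {ψ : E → ℝ} {A : ℝ} (hψm : Measurable ψ)
    (hψ : ∀ u, |ψ u| ≤ A * (1 + ‖u‖ ^ 2) ^ 2) {h₁ h₂ : E → ℝ} (hh₁ : MemLp h₁ 2 (stdGaussian E))
    (hh₂ : MemLp h₂ 2 (stdGaussian E)) :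
    Integrable (fun q : (E × E) × sphere (0 : E) 1 => collisionDensity q *
        ((ψ (collide q.2 q.1).1 + ψ (collide q.2 q.1).2 - ψ q.1.1 - ψ q.1.2) * (h₁ q.1.1 * h₂ q.1.2)))
      (((volume : Measure E).prod volume).prod sphereMeasure) := by
  obtain ⟨K, -, hK⟩ := exists_lintegral_collisionDensity_transfer_mul_le (E := E)
  have hF : AEStronglyMeasurable (fun p : E × E => h₁ p.1 * h₂ p.2) ((stdGaussian E).prod (stdGaussian E)) :=
    hh₁.1.comp_fst.mul hh₂.1.comp_snd
  have hle := hK ψ A hψ _ hF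
  rw [eLpNorm_two_tensor hh₁.1 hh₂.1] at hle
  have h1v := aestronglyMeasurable_volume_of_stdGaussian hh₁.1
  have h2v := aestronglyMeasurable_volume_of_stdGaussian hh₂.1
  refine ⟨continuous_collisionDensity.aestronglyMeasurable.mul
    ((measurable_transfer hψm).aestronglyMeasurable.mul
      ((h1v.comp_quasiMeasurePreserving quasiMeasurePreserving_fst_fst).mul
        (h2v.comp_quasiMeasurePreserving quasiMeasurePreserving_fst_snd))),
    hasFiniteIntegral_iff_enorm.2 (lt_of_le_of_lt hle ?_)⟩
  exact ENNReal.mul_lt_top (ENNReal.mul_lt_top ENNReal.ofReal_lt_top ENNReal.ofReal_lt_top)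
    (ENNReal.mul_lt_top hh₁.eLpNorm_lt_top hh₂.eLpNorm_lt_top)

/-! ### The weak formulation and the two involutions -/

/-- **Weak formulation of `L` on quartic-growth functions against `L²(M dv)`**: for `ψ` measurable
with `|ψ(v)| ≤ A (1 + |v|²)²` and `h ∈ L²(M dv)`,
`∫ B M M_* (ψ' + ψ_*' - ψ - ψ_*) h(v) dλ = ∫ h (L ψ) dM` (Fubini; the integrand is absolutely
integrable by `integrable_collisionDensity_transfer_mul_mul`). For temperate `ψ, h` this is the
first step of CIP 1994 (7.1.7) (`maxwellianInner_linearizedCollisionOp_eq`).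
[cite: CIPDiluteGases1994, §7.1 (7.1.6)] -/
theorem integral_collisionDensity_transfer_mul_eq_integral_mul_hardSphereLinearizedOp {ψ : E → ℝ}
    {A : ℝ} (hψm : Measurable ψ) (hψ : ∀ u, |ψ u| ≤ A * (1 + ‖u‖ ^ 2) ^ 2) {h : E → ℝ}
    (hh : MemLp h 2 (stdGaussian E)) :
    ∫ q, collisionDensity q * ((ψ (collide q.2 q.1).1 + ψ (collide q.2 q.1).2 - ψ q.1.1 - ψ q.1.2) *
        h q.1.1) ∂(((volume : Measure E).prod volume).prod sphereMeasure) =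
      ∫ v, h v * hardSphereLinearizedOp ψ v ∂(stdGaussian E) := by
  haveI := isFiniteMeasure_sphereMeasure (E := E)
  set K₁ : (E × E) × sphere (0 : E) 1 → ℝ := fun q => collisionDensity q *
    ((ψ (collide q.2 q.1).1 + ψ (collide q.2 q.1).2 - ψ q.1.1 - ψ q.1.2) * h q.1.1) with hK₁
  have hK₁i : Integrable K₁ (((volume : Measure E).prod volume).prod sphereMeasure) := by
    refine (integrable_collisionDensity_transfer_mul_mul hψm hψ hh (memLp_const 1)).congr
      (Eventually.of_forall fun q => ?_)
    simp only [hK₁, mul_one]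
  have h1 : ∫ v, h v * hardSphereLinearizedOp ψ v ∂(stdGaussian E) =
      ∫ v, ∫ w, ∫ ω, K₁ ((v, w), ω) ∂sphereMeasure := by
    simp only [hardSphereLinearizedOp, linearizedCollisionOp,
      integral_stdGaussian_eq_integral_mul_globalMaxwellian]
    refine integral_congr_ae (Eventually.of_forall fun v => ?_)
    dsimp only
    rw [← mul_assoc, ← integral_const_mul]
    refine integral_congr_ae (Eventually.of_forall fun w => ?_)
    dsimp only
    rw [← mul_assoc, ← integral_const_mul]
    refine integral_congr_ae (Eventually.of_forall fun ω => ?_)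
    simp only [hK₁, collisionDensity]
    ring
  have h2 : ∫ v, ∫ w, ∫ ω, K₁ ((v, w), ω) ∂sphereMeasure =
      ∫ p, ∫ ω, K₁ (p, ω) ∂sphereMeasure ∂((volume : Measure E).prod volume) :=
    (integral_prod (fun p : E × E => ∫ ω, K₁ (p, ω) ∂sphereMeasure) hK₁i.integral_prod_left).symm
  rw [h1, h2, ← integral_prod _ hK₁i]

omit [FiniteDimensional ℝ E] [MeasurableSpace E] [BorelSpace E] in
/-- The transfer is even under the exchange `(v, v_*, ω) ↦ (v_*, v, -ω)`. [folklore] -/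
theorem transfer_swap_negDir (ψ : E → ℝ) (q : (E × E) × sphere (0 : E) 1) :
    ψ (collide (-q.2) q.1.swap).1 + ψ (collide (-q.2) q.1.swap).2 - ψ q.1.swap.1 - ψ q.1.swap.2 =
      ψ (collide q.2 q.1).1 + ψ (collide q.2 q.1).2 - ψ q.1.1 - ψ q.1.2 := by
  simp only [collide_neg_dir, collide_swap, Prod.fst_swap, Prod.snd_swap]
  ring

omit [FiniteDimensional ℝ E] [MeasurableSpace E] [BorelSpace E] in
/-- The transfer is odd under the pre/post-collisional exchange `(v, v_*, ω) ↦ (v', v_*', -ω)`. [folklore] -/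
theorem transfer_collide_negDir (ψ : E → ℝ) (q : (E × E) × sphere (0 : E) 1) :
    ψ (collide (-q.2) (collide q.2 q.1)).1 + ψ (collide (-q.2) (collide q.2 q.1)).2 -
        ψ (collide q.2 q.1).1 - ψ (collide q.2 q.1).2 =
      -(ψ (collide q.2 q.1).1 + ψ (collide q.2 q.1).2 - ψ q.1.1 - ψ q.1.2) := by
  simp only [collide_neg_dir, collide_collide]
  ring

/-- **Exchange symmetry**: `∫ B M M_* (Tψ) h(v_*) dλ = ∫ B M M_* (Tψ) h(v) dλ` (change of variables
`(v, v_*, ω) ↦ (v_*, v, -ω)`; no integrability needed). [folklore] -/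
theorem integral_collisionDensity_transfer_mul_snd_eq (ψ h : E → ℝ) :
    ∫ q, collisionDensity q * ((ψ (collide q.2 q.1).1 + ψ (collide q.2 q.1).2 - ψ q.1.1 - ψ q.1.2) *
        h q.1.2) ∂(((volume : Measure E).prod volume).prod sphereMeasure) =
      ∫ q, collisionDensity q * ((ψ (collide q.2 q.1).1 + ψ (collide q.2 q.1).2 - ψ q.1.1 - ψ q.1.2) *
        h q.1.1) ∂(((volume : Measure E).prod volume).prod sphereMeasure) := by
  set K : (E × E) × sphere (0 : E) 1 → ℝ := fun q => collisionDensity q *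
    ((ψ (collide q.2 q.1).1 + ψ (collide q.2 q.1).2 - ψ q.1.1 - ψ q.1.2) * h q.1.1) with hK
  calc ∫ q, collisionDensity q * ((ψ (collide q.2 q.1).1 + ψ (collide q.2 q.1).2 - ψ q.1.1 - ψ q.1.2) *
        h q.1.2) ∂(((volume : Measure E).prod volume).prod sphereMeasure)
      = ∫ q, K (q.1.swap, -q.2) ∂(((volume : Measure E).prod volume).prod sphereMeasure) := by
        refine integral_congr_ae (Eventually.of_forall fun q => ?_)
        simp only [hK, collisionDensity_swap_negDir]
        rw [transfer_swap_negDir, Prod.fst_swap]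
    _ = ∫ q, K q ∂(((volume : Measure E).prod volume).prod sphereMeasure) := integral_comp_swap_negDir K

/-- **Pre/post antisymmetry**: `∫ B M M_* (Tψ) u(v', v_*') dλ = -∫ B M M_* (Tψ) u(v, v_*) dλ`
(change of variables `(v, v_*, ω) ↦ (v', v_*', -ω)`, under which `B M M_*` is even and `Tψ` odd; no
integrability needed). [folklore] -/
theorem integral_collisionDensity_transfer_mul_collide_eq_neg (ψ : E → ℝ) (u : E × E → ℝ) :
    ∫ q, collisionDensity q * ((ψ (collide q.2 q.1).1 + ψ (collide q.2 q.1).2 - ψ q.1.1 - ψ q.1.2) *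
        u (collide q.2 q.1)) ∂(((volume : Measure E).prod volume).prod sphereMeasure) =
      -∫ q, collisionDensity q * ((ψ (collide q.2 q.1).1 + ψ (collide q.2 q.1).2 - ψ q.1.1 - ψ q.1.2) *
        u q.1) ∂(((volume : Measure E).prod volume).prod sphereMeasure) := by
  set K : (E × E) × sphere (0 : E) 1 → ℝ := fun q => -(collisionDensity q *
    ((ψ (collide q.2 q.1).1 + ψ (collide q.2 q.1).2 - ψ q.1.1 - ψ q.1.2) * u q.1)) with hK
  calc ∫ q, collisionDensity q * ((ψ (collide q.2 q.1).1 + ψ (collide q.2 q.1).2 - ψ q.1.1 - ψ q.1.2) *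
        u (collide q.2 q.1)) ∂(((volume : Measure E).prod volume).prod sphereMeasure)
      = ∫ q, K (collide q.2 q.1, -q.2) ∂(((volume : Measure E).prod volume).prod sphereMeasure) := by
        refine integral_congr_ae (Eventually.of_forall fun q => ?_)
        simp only [hK, collisionDensity_collide_negDir, transfer_collide_negDir]
        ring
    _ = ∫ q, K q ∂(((volume : Measure E).prod volume).prod sphereMeasure) := integral_comp_collide_negDir K
    _ = _ := by
        simp only [hK, integral_neg]

end

end Literature.Analysis.UnboundedOperators
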